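import Summits.Ventures.HSemireg.SecantParityDictionary
import HarnessLib

/-!
# Venture HSemireg — the conjugate pairing on the `(1,0)`-graph of the secant exponent `B = a + t·b` is `s·H_b`
# (`t = s·i`): the KERNEL MODEL of ATTEMPT-12 §1 (1c) «`±b` a polarisation ⟺ the `(+i)`-part of the graph of `B` is
# `𝕙`-definite» in the coordinates of `SecantParityDictionary.lean` — TRACK S4-PUSH (ii), seat `s4-prove-1` (g10); file X;
# file of record `s4push/prove-1/ATTEMPT-12.md` §1 (1c) / ATTEMPT-13

HONEST FRAMING. Lean index of the computation cell `pub-hsemireg`. COORDINATE MODEL ONLY, the one of `SecantParityPolarisation.lean`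
/ `SecantParityDictionary.lean` (files (3)/(5) of the lane): `E = ℂ^g × ℂ^g = E^{1,0} ⊕ E^{0,1}`, `J = (i, -i)`, real points `(α, ᾱ)`,
`b_h = (i/2) Σ h_{jk} dz_j ∧ dz̄_k` (`bForm h`), `V = Dual E × E` with Markman's pairing `pairV` and the graph points `x₁ B y = (-B(y,·), y)`
of the null space `W_B` of `e^B`. The complex CONJUGATION of the model is written inline, `(α, β) ↦ (β̄, ᾱ)` on `E` (its fixed points are
the real points) — NO definition is introduced. No abelian variety, derived category or spinor is constructed; nothing here says that HC,
HC_CM or HC_AV holds; (S3)'s STATUS WORD does not move. Theorems only (0 def, 0 named fact, 0 sorry).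

WHAT IT ADDS. File IX (`SecantParityUpperHalfSpace`, p374441) proves that the unitary group of a hyperbolic Hermitian form carries
`𝕙`-positive graphs to `𝕙`-positive graphs; ATTEMPT-12 §1 (1c) says ON PAPER that for the secant exponent `B = a + √-d·b` the `(+i)`-part of
the graph `W_B` is `𝕙`-positive, `𝕙(w, w') := (w̄, w')_V`, exactly when `H_b > 0`. This file checks that sentence in the lane's coordinates:
* `J_conj` — the conjugation commutes with `J` (it is a real structure for the weight-one Hodge structure);
* `star_bForm_conj` — `b_h` is REAL: `conj(b_h(ȳ, ȳ')) = b_h(y, y')` for `h` Hermitian;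
* `star_secantExp_apply_conj` — hence the conjugate form of `B = b_{h_a} + t·b_{h_b}` (`t̄ = -t`) is `B̄ = b_{h_a} - t·b_{h_b}`, read on the
  conjugate of a `(1,0)`-vector: `conj(B((α,0), z̄)) = B̄((0,ᾱ), z)` — so the conjugate of the graph point `x₁ B (α, 0)` is `x₁ B̄ (0, ᾱ)`;
* **`pairV_x₁_conj_x₁_eq`** — THE VALUE: `(x₁ B̄ (0,ᾱ), x₁ B (α,0))_V = -i·t·(αᵀ h_b ᾱ)`: the real part `h_a` DROPS OUT (as in S3INP-3's `g_P`);
* **`pairV_x₁_conj_x₁_eq_smul_bForm_realPt`** — for `t = s·i` (`s` real, `s = √d`): `= s · b_{h_b}((α,ᾱ), J(α,ᾱ)) = s · H_{h_b}(ᾱ)`, the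
  Hermitian form of `b` at the real point;
* **`posDef_iff_forall_pairV_x₁_conj_x₁_pos`** / `…_neg` — for `s > 0`: `h_b` positive definite ⟺ the conjugate pairing is `> 0` on every
  non-zero `(1,0)`-graph point; `-h_b` positive definite ⟺ it is `< 0` there. So «`±b` a polarisation ⟺ `W_B^{1,0}` is `𝕙`-definite», kernel.
* §5 THE MATRIX: the `(1,0)`-graph of `B` is the graph of `-i·Z`, `Z := ½(h_a + t·h_b)ᵀ` (`x₁_secantExp_fst_apply`); `i(Zᴴ - Z) = -i·t·h_bᵀ`
  (`I_smul_conjTranspose_sub_dictZ`); the conjugate pairing IS file IX's quadratic form `ᾱᵀ i(Zᴴ - Z) α` (`pairV_x₁_conj_x₁_eq_star_dotProduct_dictZ`);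
  and file IX's hypothesis `i(Zᴴ - Z) > 0` ⟺ `h_b > 0` (`posDef_im_dictZ_iff`) — the dictionary step of ATTEMPT-12 §1 (1c) in full, kernel in the model.

CONVENTIONS (s4-ref g22 pre-filing read, VERDICT-PROVE1-FILEX-…-2026-08-24.md ac5450a6149cc52b, P-X-1..3). (P-X-1) The conjugation of the model is
`(α, β) ↦ (β̄, ᾱ)` on `E` and the INDUCED one on `Dual E`, `φ ↦ conj ∘ φ ∘ conj`; the Hermitian form of ATTEMPT-12 §1 (1c) is `𝕙(w, w') := (w̄, w')_V`
with `w̄` taken componentwise, and `star_secantExp_apply_conj` is exactly the statement «the conjugate of `x₁ B (α, 0)` is `x₁ B̄ (0, ᾱ)`» read through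
that induced conjugation (no `conj` is defined in Lean; it is unfolded in each statement). (P-X-2) That the `(1,0)`-graph `{x₁ B (α, 0)}` IS the `(+i)`-part
`W_B^{1,0}` of the graph of `B` for the complex structure `I_V` is the tree's `Polarisation.IV_x₁` (with `bForm_J`: `B` is `J`-invariant), file (3).
(P-X-3) SIGNS: the kernel pair (`x₁ B y = (-ι_y B, y)`, `H_h(α) := b_h(y, Jy)` at the real point, file (5)'s `bForm_realPt_J`) and the paper pair of (1c)
(`(v, ι_v B)`, Lange's `H(u,u) = b(Ju, u)`) each state the SAME condition — the two sign flips cancel; «`h_b` positive definite» below means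
`b_{h_b}(y, Jy) > 0` at real points (the Kähler sign of file (5); Lange's `Im H` carries the opposite sign; lattice integrality is not modelled), and the
`±`-symmetric sentences are convention-free. KERNEL ×2: s4-ref g22 re-ran a byte-identical copy (rc 0) and re-derived `pairV_x₁_conj_x₁_eq` by hand.

Statements and proofs: s4-prove-1 g10 (2026-08-24); reads: s4-ref g22 NO OBJECTION TO FILING (pre-filing, draft-v2); s4-prove-3 (×2) invited.

## References

* [Markman2025SecantWeil] E. Markman, arXiv:2502.03415, §2.2 (pure spinors, `W₁`, `W₂ = W̄₁`), §2.4 eq. (2.4.5), Lemma 2.4.2, Prop. 2.4.4 — as in files (3)/(5).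
* [Lange2023AbelianVarietiesComplex] H. Lange, Abelian Varieties over the Complex Numbers (2023), §1.2 Lemma 1.2.10 (`H(v,w) = E(iv,w) + iE(v,w)`), §2.1.1.
* [Satake1980AlgebraicStructures] I. Satake, Algebraic Structures of Symmetric Domains (1980), Appendix §3 (I_{p,q}) (3.15)–(3.16) — dictionary only.
* Cell records: ATTEMPT-12.md §1 (1c); STATEMENTS-S3INPUT.md S3INP-3, S3INP-13; files `SecantParityPolarisation.lean`, `SecantParityDictionary.lean`, `SecantParityUpperHalfSpace.lean`.
-/

noncomputable section

namespace Summit.Ventures.HSemireg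

namespace SecantParity

namespace Dictionary

open scoped ComplexOrder
open Matrix
open Summit.Ventures.HSemireg.SecantParity.Polarisation (pairV x₁)

variable {g : ℕ}

/-! ### §1 The real structure `(α, β) ↦ (β̄, ᾱ)` of the model -/

/-- The conjugation `(α, β) ↦ (β̄, ᾱ)` commutes with `J = (i, -i)`: `J(β̄, ᾱ) = ((Jy).2‾, (Jy).1‾)` — `J` is defined over `ℝ`.
[cite: Markman2025SecantWeil, §2.4 Lemma 2.4.2] -/
theorem J_conj (y : E g) : J (star y.2, star y.1) = (star (J y).2, star (J y).1) := by
  ext i <;> simp [J_apply, Complex.conj_I]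

/-- The real points are fixed: `(ᾱ‾, ᾱ) = (α, ᾱ)`. [cite: Markman2025SecantWeil, §2.4 Lemma 2.4.2] -/
theorem conj_realPt (α : Fin g → ℂ) : (star (realPt α).2, star (realPt α).1) = realPt α := by
  simp [realPt]

/-! ### §2 `b_h` is a real form for Hermitian `h`; the conjugate exponent -/

/-- **`b_h` is REAL**: `conj (b_h((β̄, ᾱ), (β̄', ᾱ'))) = b_h((α, β), (α', β'))` for `h` Hermitian — the `(1,1)`-form with Hermitian
matrix `h` takes conjugate values on conjugate vectors. [cite: Lange2023AbelianVarietiesComplex, §1.2 Lemma 1.2.10] -/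
theorem star_bForm_conj {h : Matrix (Fin g) (Fin g) ℂ} (hh : hᴴ = h) (y y' : E g) :
    star (bForm h (star y.2, star y.1) (star y'.2, star y'.1)) = bForm h y y' := by
  have key : ∀ a b : Fin g → ℂ, star (star a ⬝ᵥ (h *ᵥ star b)) = b ⬝ᵥ (h *ᵥ a) := fun a b ↦ by
    rw [star_dotProduct, star_star, star_mulVec, star_star, hh, ← dotProduct_mulVec]
  rw [bForm_apply, bForm_apply, star_mul', star_sub, key, key, star_div₀, Complex.star_def, Complex.conj_I,
    map_ofNat]
  ring

/-- **The conjugate exponent, read on a `(1,0)`-vector**: for `B = b_{h_a} + t·b_{h_b}` with `h_a, h_b` Hermitian and `t̄ = -t`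
(`t = √-d`), `conj (B((α, 0), (β̄', ᾱ'))) = B̄((0, ᾱ), (α', β'))` with `B̄ = b_{h_a} - t·b_{h_b}` — i.e. the conjugate of the graph point
`x₁ B (α, 0) = (-B((α,0), ·), (α, 0))` of `W_B` is the graph point `x₁ B̄ (0, ᾱ)` of `W_{B̄} = W̄_B` (`(0, ᾱ)` is the conjugate of `(α, 0)`).
[cite: Markman2025SecantWeil, §2.2 («`W₂` is the complex conjugate of `W₁`»)] -/
theorem star_secantExp_apply_conj {ha hb : Matrix (Fin g) (Fin g) ℂ} (hha : haᴴ = ha) (hhb : hbᴴ = hb) {t : ℂ} (ht : star t = -t)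
    (α : Fin g → ℂ) (z : E g) :
    star ((bForm ha + t • bForm hb) (α, 0) (star z.2, star z.1)) = (bForm ha - t • bForm hb) (0, star α) z := by
  have hu : ((α, 0) : E g) = (star ((0, star α) : E g).2, star ((0, star α) : E g).1) := by simp
  rw [LinearMap.add_apply, LinearMap.smul_apply, LinearMap.add_apply, LinearMap.smul_apply, smul_eq_mul, star_add, star_mul',
    hu, star_bForm_conj hha, star_bForm_conj hhb, ht, LinearMap.sub_apply, LinearMap.smul_apply, LinearMap.sub_apply,
    LinearMap.smul_apply, smul_eq_mul]
  ring

/-! ### §3 The conjugate pairing on the `(1,0)`-graph of `B` -/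

/-- The pairing of two graph points across the types: `(x₁ B' (0, β), x₁ B (α, 0))_V = -B'((0,β),(α,0)) - B((α,0),(0,β))`.
[cite: Markman2025SecantWeil, §2.4 eq. (2.4.5) and Lemma 2.4.2] -/
theorem pairV_x₁_zeroOne_x₁_oneZero (B B' : E g →ₗ[ℂ] E g →ₗ[ℂ] ℂ) (α β : Fin g → ℂ) :
    pairV (x₁ B' ((0 : Fin g → ℂ), β)) (x₁ B (α, 0)) = -(B' (0, β) (α, 0)) - B (α, 0) (0, β) := by
  simp only [pairV, x₁, LinearMap.neg_apply]
  ring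

/-- `b_h` across the types: `b_h((α,0),(0,β)) = (i/2)·αᵀ h β` and `b_h((0,β),(α,0)) = -(i/2)·αᵀ h β`.
[cite: Lange2023AbelianVarietiesComplex, §1.7 Lemma 1.7.4] -/
theorem bForm_oneZero_zeroOne (h : Matrix (Fin g) (Fin g) ℂ) (α β : Fin g → ℂ) :
    bForm h (α, 0) (0, β) = (Complex.I / 2) * (α ⬝ᵥ (h *ᵥ β)) ∧
      bForm h (0, β) (α, 0) = -((Complex.I / 2) * (α ⬝ᵥ (h *ᵥ β))) := by
  constructor <;> · rw [bForm_apply]; simp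

/-- **THE VALUE OF THE CONJUGATE PAIRING ON THE `(1,0)`-GRAPH**: for `B = b_{h_a} + t·b_{h_b}`, `B̄ = b_{h_a} - t·b_{h_b}`:
`𝕙(x₁ B (α,0)) := (x₁ B̄ (0, ᾱ), x₁ B (α, 0))_V = -i·t·(αᵀ h_b ᾱ)` — the real part `h_a` drops out.
[cite: Markman2025SecantWeil, §2.4 proof of Prop. 2.4.4] [cite: Satake1980AlgebraicStructures, Appendix §3 (I_{p,q}) eq. (3.15)] -/
theorem pairV_x₁_conj_x₁_eq (ha hb : Matrix (Fin g) (Fin g) ℂ) (t : ℂ) (α : Fin g → ℂ) :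
    pairV (x₁ (bForm ha - t • bForm hb) ((0 : Fin g → ℂ), star α)) (x₁ (bForm ha + t • bForm hb) (α, 0)) =
      -(Complex.I * t) * (α ⬝ᵥ (hb *ᵥ star α)) := by
  rw [pairV_x₁_zeroOne_x₁_oneZero, LinearMap.sub_apply, LinearMap.smul_apply, LinearMap.sub_apply, LinearMap.smul_apply,
    LinearMap.add_apply, LinearMap.smul_apply, LinearMap.add_apply, LinearMap.smul_apply, smul_eq_mul, smul_eq_mul,
    (bForm_oneZero_zeroOne ha α (star α)).1, (bForm_oneZero_zeroOne ha α (star α)).2,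
    (bForm_oneZero_zeroOne hb α (star α)).1, (bForm_oneZero_zeroOne hb α (star α)).2]
  ring

/-- **… as the Hermitian form of `b` at the real point**: for `t = s·i` (`s` real; `s = √d` in the dictionary),
`(x₁ B̄ (0,ᾱ), x₁ B (α,0))_V = s · b_{h_b}((α, ᾱ), J(α, ᾱ))` (`= s · ᾱᵀ h_b‾… = s·H_{h_b}(ᾱ)`, file (5)'s `bForm_realPt_J`).
[cite: Lange2023AbelianVarietiesComplex, §2.1.1] [cite: Markman2025SecantWeil, §2.4 Prop. 2.4.4] -/
theorem pairV_x₁_conj_x₁_eq_smul_bForm_realPt (ha hb : Matrix (Fin g) (Fin g) ℂ) (s : ℝ) (α : Fin g → ℂ) :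
    pairV (x₁ (bForm ha - ((s : ℂ) * Complex.I) • bForm hb) ((0 : Fin g → ℂ), star α))
        (x₁ (bForm ha + ((s : ℂ) * Complex.I) • bForm hb) (α, 0)) =
      (s : ℂ) * bForm hb (realPt α) (J (realPt α)) := by
  rw [pairV_x₁_conj_x₁_eq, bForm_realPt_J, star_star, show -(Complex.I * ((s : ℂ) * Complex.I)) = (s : ℂ) by
    rw [mul_left_comm, Complex.I_mul_I]; ring]

/-! ### §4 The dictionary: `±b` a polarisation ⟺ the `(1,0)`-graph of `B` is `𝕙`-definite -/

/-- **`h_b > 0` ⟺ the conjugate pairing is POSITIVE on every non-zero `(1,0)`-graph point** (`s > 0`, `h_b` Hermitian): `b` is a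
polarisation exactly when `W_B^{1,0}` is an `𝕙`-positive `n`-plane, `𝕙(w, w') = (w̄, w')_V`.
[cite: Markman2025SecantWeil, §2.4 Prop. 2.4.4] [cite: Satake1980AlgebraicStructures, Appendix §3 (I_{p,q}) eqs. (3.15)–(3.16)] -/
theorem posDef_iff_forall_pairV_x₁_conj_x₁_pos {ha hb : Matrix (Fin g) (Fin g) ℂ} (hhb : hb.IsHermitian) {s : ℝ} (hs : 0 < s) :
    hb.PosDef ↔ ∀ α : Fin g → ℂ, α ≠ 0 →
      0 < pairV (x₁ (bForm ha - ((s : ℂ) * Complex.I) • bForm hb) ((0 : Fin g → ℂ), star α))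
        (x₁ (bForm ha + ((s : ℂ) * Complex.I) • bForm hb) (α, 0)) := by
  rw [posDef_iff_bForm_realPt_pos hhb]
  have hs' : (0 : ℂ) < (s : ℂ) := by exact_mod_cast hs
  refine ⟨fun h α hα ↦ ?_, fun h α hα ↦ ?_⟩
  · rw [pairV_x₁_conj_x₁_eq_smul_bForm_realPt]
    exact mul_pos hs' (h α hα)
  · have h1 := h α hα
    rw [pairV_x₁_conj_x₁_eq_smul_bForm_realPt] at h1
    have hinv : (0 : ℂ) < ((s⁻¹ : ℝ) : ℂ) := by exact_mod_cast inv_pos.2 hs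
    have h2 := mul_pos hinv h1
    rwa [← mul_assoc, ← Complex.ofReal_mul, inv_mul_cancel₀ hs.ne', Complex.ofReal_one, one_mul] at h2

/-- **`-h_b > 0` ⟺ the conjugate pairing is NEGATIVE on every non-zero `(1,0)`-graph point** (`s > 0`): `-b` is a polarisation exactly
when `W_B^{1,0}` is `𝕙`-negative. [cite: Markman2025SecantWeil, §2.4 Prop. 2.4.4] [cite: Satake1980AlgebraicStructures, Appendix §3 (I_{p,q}) eqs. (3.15)–(3.16)] -/
theorem neg_posDef_iff_forall_pairV_x₁_conj_x₁_neg {ha hb : Matrix (Fin g) (Fin g) ℂ} (hhb : hb.IsHermitian) {s : ℝ} (hs : 0 < s) :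
    (-hb).PosDef ↔ ∀ α : Fin g → ℂ, α ≠ 0 →
      pairV (x₁ (bForm ha - ((s : ℂ) * Complex.I) • bForm hb) ((0 : Fin g → ℂ), star α))
        (x₁ (bForm ha + ((s : ℂ) * Complex.I) • bForm hb) (α, 0)) < 0 := by
  have hneg : ∀ α : Fin g → ℂ,
      pairV (x₁ (bForm ha - ((s : ℂ) * Complex.I) • bForm (-hb)) ((0 : Fin g → ℂ), star α))
        (x₁ (bForm ha + ((s : ℂ) * Complex.I) • bForm (-hb)) (α, 0)) =
      -pairV (x₁ (bForm ha - ((s : ℂ) * Complex.I) • bForm hb) ((0 : Fin g → ℂ), star α))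
        (x₁ (bForm ha + ((s : ℂ) * Complex.I) • bForm hb) (α, 0)) := fun α ↦ by
    rw [pairV_x₁_conj_x₁_eq, pairV_x₁_conj_x₁_eq, neg_mulVec, dotProduct_neg]
    ring
  rw [posDef_iff_forall_pairV_x₁_conj_x₁_pos (ha := ha) hhb.neg hs]
  refine forall_congr' fun α ↦ forall_congr' fun hα ↦ ?_
  rw [hneg, neg_pos]

/-! ### §5 The matrix of the dictionary: `Z = ½(h_a + t·h_b)ᵀ`, with file IX's hypothesis shape `i(Zᴴ - Z) > 0 ⟺ h_b > 0` -/

/-- **The `(1,0)`-graph of `B` is the graph of `-i·Z`, `Z := ½(h_a + t·h_b)ᵀ`**: the first component of the graph point `x₁ B (α, 0)` is the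
functional `z ↦ (-i·Zα)ᵀ z₂` (pairing with the `(0,1)`-coordinate only). In the coordinates `(α, ψ)`, `ψ := i·(first component)`, Markman's
conjugate pairing is file IX's hyperbolic form `-iᾱᵀψ' + iψ̄ᵀα'` (ATTEMPT-12 §1 (1c)). [cite: Markman2025SecantWeil, §2.4 eq. (2.4.5)] -/
theorem x₁_secantExp_fst_apply (ha hb : Matrix (Fin g) (Fin g) ℂ) (t : ℂ) (α : Fin g → ℂ) (z : E g) :
    (x₁ (bForm ha + t • bForm hb) (α, 0)).1 z =
      (-(Complex.I • ((((1 / 2 : ℂ) • (ha + t • hb))ᵀ) *ᵥ α))) ⬝ᵥ z.2 := by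
  simp only [x₁, LinearMap.neg_apply, LinearMap.add_apply, LinearMap.smul_apply, smul_eq_mul, bForm_apply,
    mulVec_zero, dotProduct_zero, neg_dotProduct, smul_dotProduct, mulVec_transpose, ← dotProduct_mulVec, smul_mulVec,
    add_mulVec, dotProduct_add, dotProduct_smul]
  ring

/-- **`i(Zᴴ - Z) = -i·t·h_bᵀ` for `Z = ½(h_a + t·h_b)ᵀ`** (`h_a, h_b` Hermitian, `t̄ = -t`): the real part cancels, and for `t = s·i` this is
`s·h_bᵀ` — file IX's `Im Z` is (a positive multiple of) the transpose of the Hermitian matrix of `b`.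
[cite: Lange2023AbelianVarietiesComplex, §1.2 Lemma 1.2.10] -/
theorem I_smul_conjTranspose_sub_dictZ {ha hb : Matrix (Fin g) (Fin g) ℂ} (hha : haᴴ = ha) (hhb : hbᴴ = hb) {t : ℂ} (ht : star t = -t) :
    Complex.I • ((((1 / 2 : ℂ) • (ha + t • hb))ᵀ)ᴴ - ((1 / 2 : ℂ) • (ha + t • hb))ᵀ) = (-(Complex.I * t)) • hbᵀ := by
  ext i j
  have h1 : star (ha i j) = ha j i := by simpa [conjTranspose_apply] using congrFun (congrFun hha j) i
  have h2 : star (hb i j) = hb j i := by simpa [conjTranspose_apply] using congrFun (congrFun hhb j) i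
  have h3 : star (1 / 2 : ℂ) = 1 / 2 := by simp
  simp only [Matrix.smul_apply, Matrix.sub_apply, Matrix.add_apply, conjTranspose_apply, transpose_apply, smul_eq_mul,
    star_mul', star_add, h1, h2, h3, ht]
  ring

/-- **THE CONJUGATE PAIRING IS FILE IX's QUADRATIC FORM**: `(x₁ B̄ (0,ᾱ), x₁ B (α,0))_V = ᾱᵀ·i(Zᴴ - Z)·α` for `Z = ½(h_a + t·h_b)ᵀ` — the
`𝕙`-value on the `(1,0)`-graph of `B` is the value of file IX's `Im`-form at `α`. [cite: Markman2025SecantWeil, §2.4 Prop. 2.4.4] [cite: Satake1980AlgebraicStructures, Appendix §3 (I_{p,q}) eq. (3.15)] -/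
theorem pairV_x₁_conj_x₁_eq_star_dotProduct_dictZ {ha hb : Matrix (Fin g) (Fin g) ℂ} (hha : haᴴ = ha) (hhb : hbᴴ = hb) {t : ℂ}
    (ht : star t = -t) (α : Fin g → ℂ) :
    pairV (x₁ (bForm ha - t • bForm hb) ((0 : Fin g → ℂ), star α)) (x₁ (bForm ha + t • bForm hb) (α, 0)) =
      star α ⬝ᵥ ((Complex.I • ((((1 / 2 : ℂ) • (ha + t • hb))ᵀ)ᴴ - ((1 / 2 : ℂ) • (ha + t • hb))ᵀ)) *ᵥ α) := by
  rw [I_smul_conjTranspose_sub_dictZ hha hhb ht, pairV_x₁_conj_x₁_eq, smul_mulVec, dotProduct_smul, smul_eq_mul, mulVec_transpose,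
    dotProduct_comm (star α), ← dotProduct_mulVec]

/-- **File IX's hypothesis on the dictionary matrix ⟺ `b` a polarisation**: for `Z = ½(h_a + s·i·h_b)ᵀ` (`s > 0`, `h_a, h_b` Hermitian),
`i(Zᴴ - Z)` is positive definite iff `h_b` is. [cite: Lange2023AbelianVarietiesComplex, §1.2 Lemma 1.2.10] [cite: Satake1980AlgebraicStructures, Appendix §3 (I_{p,q}) eq. (3.15)] -/
theorem posDef_im_dictZ_iff {ha hb : Matrix (Fin g) (Fin g) ℂ} (hha : haᴴ = ha) (hhb : hb.IsHermitian) {s : ℝ} (hs : 0 < s) :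
    (Complex.I • ((((1 / 2 : ℂ) • (ha + ((s : ℂ) * Complex.I) • hb))ᵀ)ᴴ - ((1 / 2 : ℂ) • (ha + ((s : ℂ) * Complex.I) • hb))ᵀ)).PosDef ↔
      hb.PosDef := by
  have ht : star ((s : ℂ) * Complex.I) = -((s : ℂ) * Complex.I) := by simp [Complex.conj_ofReal]
  rw [I_smul_conjTranspose_sub_dictZ hha hhb ht, show -(Complex.I * ((s : ℂ) * Complex.I)) = ((s : ℝ) : ℂ) by
    rw [mul_left_comm, Complex.I_mul_I]; ring]
  constructor
  · intro h
    have h1 : ((((s⁻¹ : ℝ) : ℂ)) • ((s : ℂ) • hbᵀ)).PosDef := by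
      refine PosDef.of_dotProduct_mulVec_pos ?_ fun x hx ↦ ?_
      · rw [Matrix.IsHermitian, conjTranspose_smul, h.isHermitian.eq, Complex.star_def, Complex.conj_ofReal]
      · rw [smul_mulVec, dotProduct_smul, smul_eq_mul]
        exact mul_pos (by exact_mod_cast inv_pos.2 hs) (h.dotProduct_mulVec_pos hx)
    rw [smul_smul, ← Complex.ofReal_mul, inv_mul_cancel₀ hs.ne', Complex.ofReal_one, one_smul] at h1
    simpa using h1.transpose
  · intro h
    refine PosDef.of_dotProduct_mulVec_pos ?_ fun x hx ↦ ?_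
    · rw [Matrix.IsHermitian, conjTranspose_smul, h.transpose.isHermitian.eq, Complex.star_def, Complex.conj_ofReal]
    · rw [smul_mulVec, dotProduct_smul, smul_eq_mul]
      exact mul_pos (by exact_mod_cast hs) (h.transpose.dotProduct_mulVec_pos hx)

end Dictionary

end SecantParity

end Summit.Ventures.HSemireg
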